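import Mathlib
import HarnessLib
import Summits.CriticalPhenomena.PercolationContinuityZ3.Theses.PercTreeValue
import Summits.CriticalPhenomena.PercolationContinuityZ3.Theorems.PercTreeValueTetrahedronDisjointCoexistenceTransferC
import Summits.CriticalPhenomena.PercolationContinuityZ3.Theorems.PercTreeValueTetrahedronDisjointCoexistenceTransferB
import Summits.CriticalPhenomena.PercolationContinuityZ3.Theorems.PercTreeValueTetrahedronDisjointCoexistenceStubShellDecoupling
import Summits.CriticalPhenomena.PercolationContinuityZ3.Theorems.PercTreeValueTetrahedronDisjointCoexistenceStubShiftBoxCrossing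
import Summits.CriticalPhenomena.PercolationContinuityZ3.Theorems.PercTreeValueTetrahedronDisjointCoexistenceStubMirrorRestrict
import Summits.CriticalPhenomena.PercolationContinuityZ3.Theorems.PercTreeValueTetrahedronDisjointCoexistenceStubPairSymm
import Summits.CriticalPhenomena.PercolationContinuityZ3.Theorems.PercTreeValueTetrahedronDisjointCoexistenceStubRestrictProduct
import Summits.CriticalPhenomena.PercolationContinuityZ3.Theorems.PercTreeValueTetrahedronDisjointCoexistenceStubConfineProduct
import Summits.CriticalPhenomena.PercolationContinuityZ3.Theorems.PercTreeValueTetrahedronDisjointCoexistenceStubRestrictSymm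
import Literature.Probability.Percolation.TwoPointFunction
import Literature.Probability.Percolation.TreeGraphBound
import Literature.Probability.Percolation.RSW
import Literature.Probability.Percolation.FiniteEnergy
import Literature.Probability.Percolation.SharpnessDCTProofs
import Literature.Probability.Percolation.SlabCriticality
import Literature.Probability.LatticeModels.ThermodynamicLimit

/-!
# Route PercTreeValue — link for the crux `TetrahedronDisjointCoexistence` (stmt-CriticalPhenomena-7798):
# X_B ∧ core restriction (line `Sketch`) ⇒ interface blocking (line `SketchIdeator2`, composition B)

Line `Sketch` (lead prover-line-stmt-CriticalPhenomena-7798-c1-0), registered link stub S9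
`stub_interfaceBlocking_of_shellRestriction`. With `a_r = (r,r,0)`, `b_r = (r,0,r)`, `c_r = (0,r,r)`,
`k = ⌊r/8⌋`, `K = k + 1`, `v_r = (4K, 4K, −4K)`, `n_r = 5K`, `H_r = {x | 2x₂ + 2 ≤ r}`,
`U_r = {x | r + 2 ≤ 2x₂}`:

* `Core_r := [−k, r+k]² × [−(r+k), k] ⊆ H_r` (`r ≥ 56`), `Outer_r := v_r + B(10K)`,
  `W_r := {x | 6K + 1 ≤ x₂} ⊆ U_r`, `Shell(R,R')` := no open path of `R' ∖ R` from a vertex adjacent to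
  `R` to a vertex adjacent to `R'ᶜ`.
* `linkBlocking_shellDecoupling` — the RESTRICTED-conclusion form of the closed-shell decoupling
  `stub_shellDecoupling`: for `R ⊆ R_big`, `W ⊆ W_big`,
  `P(x₁ ↔_R y₁) · P(Shell(R,R')) · P(x₂ ↔_W y₂) ≤ P(x₁ ↔_{R_big} y₁, x₂ ↔_{W_big} y₂, x₁ ↮ x₂)`
  (same independence over the pairwise disjoint pair sets `R.sym2`, `(R' ∖ R).sym2`, `W.sym2`; the
  pointwise inclusion is `shellDecoupling_subset` for `x₁ ↮ x₂` and monotonicity of restricted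
  connections in the region for the other two conjuncts).
* `stub_interfaceBlocking_of_shellRestriction` — the HYPOTHESES are X_B =
  `PercAnnulusCrossing.CritAnnulusNonCrossing` (stmt-CriticalPhenomena-0846, verbatim) and CORE
  RESTRICTION (`P(0 ↔ a_r inside Core_r) ≥ c τ(0,a_r)`), exactly as in transfer C
  (`stub_cruxOfShellRestriction`); the CONCLUSION is VERBATIM the registered open stub
  `stub_interfaceBlocking` (S13) of `Lines/SketchIdeator2.lean`, with `c₂ = c_X c²`:
  `c₂ P(0 ↔_{H_r} a_r, b_r ↔_{U_r} c_r) = c₂ P(0 ↔_{H_r} a_r) P(b_r ↔_{U_r} c_r)` (`stub_restrictProduct`)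
  `≤ c_X (c τ(0,a_r))²` (`stub_restrictSymm`, restricted connections are connections)
  `≤ P(0 ↔_{Core_r} a_r) · P(Shell(Core_r, Outer_r)) · P(b_r ↔_{W_r} c_r)` (core restriction twice, the
  second through `stub_mirrorRestrict`; the shell from the translated X_B annulus,
  `transferC_shell_superset_compl` + `stub_shiftBoxCrossing`) `≤ P(0 ↔_{H_r} a_r, b_r ↔_{U_r} c_r, 0 ↮ b_r)`
  (`linkBlocking_shellDecoupling`).

So the open pair of line `Sketch` is a SUFFICIENT condition for the open pair (restriction positivity,
interface blocking) of composition B of line `SketchIdeator2`. No new definitions.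
-/

noncomputable section

namespace Summit.CriticalPhenomena.PercolationContinuityZ3.Theorems.TetrahedronDisjointCoexistence

open MeasureTheory
open Literature.Probability.Percolation Literature.Probability.LatticeModels

variable {V : Type*}

/-- **Pointwise heart, restricted form.** For `ω` whose lattice part `ω ∩ E(G)` lies in
`{x₁ ↔ y₁ in R} ∩ Shell(R, R') ∩ {x₂ ↔ y₂ in W}` (`R ⊆ R'`, neighbours of `R` in `R'`, `W ∩ R' = ∅`)
and regions `R ⊆ R_big`, `W ⊆ W_big`: `x₁ ↔ y₁ in R_big`, `x₂ ↔ y₂ in W_big` (monotonicity in the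
region) and `x₁ ↮ x₂` (`shellDecoupling_subset`). -/
theorem linkBlocking_preimage_subset (G : SimpleGraph V) {R R' W Rb Wb : Set V} (hRR' : R ⊆ R')
    (hN : ∀ x ∈ R, ∀ y, G.Adj x y → y ∈ R') (hW : Disjoint R' W) (hRb : R ⊆ Rb) (hWb : W ⊆ Wb)
    (x₁ y₁ x₂ y₂ : V) :
    (fun ω : BondConfig V => ω ∩ G.edgeSet) ⁻¹'
        (openConnIn R x₁ y₁ ∩
          {ω : BondConfig V | ∀ u ∈ R' \ R, ∀ w ∈ R' \ R, (∃ z ∈ R, G.Adj u z) →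
            (∃ z ∉ R', G.Adj w z) → ω ∉ openConnIn (R' \ R) u w} ∩
          openConnIn W x₂ y₂) ⊆
      (fun ω : BondConfig V => ω ∩ G.edgeSet) ⁻¹'
        (openConnIn Rb x₁ y₁ ∩ openConnIn Wb x₂ y₂ ∩ (openConn x₁ x₂)ᶜ) := by
  intro ω hω
  simp only [Set.mem_inter_iff, Set.mem_preimage] at hω ⊢
  obtain ⟨⟨h₁, h₂⟩, h₃⟩ := hω
  exact ⟨⟨openConnIn_mono hRb x₁ y₁ h₁, openConnIn_mono hWb x₂ y₂ h₃⟩,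
    (shellDecoupling_subset G hRR' hN hW x₁ y₁ x₂ y₂ Set.inter_subset_right h₁ h₂ h₃).2⟩

/-- **Closed-shell decoupling, restricted-conclusion form** (on every countable graph and at every
`p`). For vertex sets `R ⊆ R'` with every neighbour of `R` inside `R'`, `W` disjoint from `R'`, and
regions `R ⊆ R_big`, `W ⊆ W_big`:
`P(x₁ ↔ y₁ in R) · P(Shell(R, R')) · P(x₂ ↔ y₂ in W) ≤ P(x₁ ↔ y₁ in R_big, x₂ ↔ y₂ in W_big, x₁ ↮ x₂)`.
The three events live on the pairwise disjoint pair sets `R.sym2`, `(R' ∖ R).sym2`, `W.sym2`, hence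
are independent (`bondPercolation_real_inter_of_disjoint` twice), and a.s. their intersection lies in
the target (`linkBlocking_preimage_subset`, `real_preimage_inter_edgeSet`). -/
theorem linkBlocking_shellDecoupling {V : Type*} [Countable V] (G : SimpleGraph V) (p : unitInterval)
    {R R' W Rb Wb : Set V} (hRR' : R ⊆ R') (hN : ∀ x ∈ R, ∀ y, G.Adj x y → y ∈ R')
    (hW : Disjoint R' W) (hRb : R ⊆ Rb) (hWb : W ⊆ Wb) (x₁ y₁ x₂ y₂ : V) :
    (bondPercolation G p).real (openConnIn R x₁ y₁) *
          (bondPercolation G p).real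
            {ω | ∀ u ∈ R' \ R, ∀ w ∈ R' \ R, (∃ z ∈ R, G.Adj u z) → (∃ z ∉ R', G.Adj w z) →
              ω ∉ openConnIn (R' \ R) u w} *
        (bondPercolation G p).real (openConnIn W x₂ y₂) ≤
      (bondPercolation G p).real
        (openConnIn Rb x₁ y₁ ∩ openConnIn Wb x₂ y₂ ∩ (openConn x₁ x₂)ᶜ) := by
  -- measurability and supports of the three events
  have hm₁ := restrictProduct_measurableSet_openConnIn (V := V) R x₁ y₁
  have hm₂ := shellDecoupling_measurableSet_shell G R R'
  have hm₃ := restrictProduct_measurableSet_openConnIn (V := V) W x₂ y₂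
  have hA₁ := DCT16.determinedBy_openConnIn R x₁ y₁ (K := R.sym2) le_rfl
  have hA₂ := shellDecoupling_determinedBy_shell G R R' (K := (R' \ R).sym2) le_rfl
  have hA₁₂ := (DCT16.determinedBy_openConnIn R x₁ y₁ (sym2_mono hRR')).inter
    (shellDecoupling_determinedBy_shell G R R' (sym2_mono Set.sdiff_subset))
  have hA₃ := DCT16.determinedBy_openConnIn W x₂ y₂ (K := W.sym2) le_rfl
  have hd₁ : Disjoint R.sym2 (R' \ R).sym2 := restrictProduct_disjoint_sym2 Set.disjoint_sdiff_right
  have hd₂ : Disjoint R'.sym2 W.sym2 := restrictProduct_disjoint_sym2 hW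
  -- a.s. inclusion of the intersection in the target, then independence twice
  have key := measureReal_mono (μ := bondPercolation G p)
    (linkBlocking_preimage_subset G hRR' hN hW hRb hWb x₁ y₁ x₂ y₂)
  rw [real_preimage_inter_edgeSet, real_preimage_inter_edgeSet,
    bondPercolation_real_inter_of_disjoint G p hd₂ hA₁₂ hA₃ (hm₁.inter hm₂) hm₃,
    bondPercolation_real_inter_of_disjoint G p hd₁ hA₁ hA₂ hm₁ hm₂] at key
  exact key

/-- **Link S9 (line `Sketch` ⇒ composition B of line `SketchIdeator2`).** X_B
(`PercAnnulusCrossing.CritAnnulusNonCrossing`, verbatim) and core restriction at relative depth `1/8`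
give INTERFACE BLOCKING — verbatim the registered open stub `stub_interfaceBlocking` of
`Lines/SketchIdeator2.lean` — with `c₂ = c_X · c²` and `r₀ ↦ max r₀ 56`: the two half-space-restricted
events are independent (`stub_restrictProduct`) and bounded by `τ(0,a_r)` each (`stub_restrictSymm`),
core restriction (twice, the second through the rotoreflection `stub_mirrorRestrict`) and the translated
X_B annulus `v_r + (B(10K) ∖ B(5K))` around `Core_r` (`transferC_shell_superset_compl`,
`stub_shiftBoxCrossing`) bound `c_X (c τ(0,a_r))²` by the decoupled triple product, and the
restricted-conclusion closed-shell decoupling `linkBlocking_shellDecoupling` (`Core_r ⊆ H_r`,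
`W_r ⊆ U_r`) concludes. -/
theorem stub_interfaceBlocking_of_shellRestriction
    (hXB : ∃ c : ℝ, 0 < c ∧ ∀ n : ℕ, 1 ≤ n →
      (bondPercolation (zdGraph 3) (criticalProbI 3)).real
          {ω | ∃ x ∈ box 3 n, ∃ y ∈ innerBoundary (zdGraph 3) (box 3 (2 * n)),
            ω ∈ openConnIn ↑(box 3 (2 * n)) x y} ≤ 1 - c)
    (hCore : ∃ c : ℝ, 0 < c ∧ ∃ r₀ : ℕ, ∀ r : ℕ, r₀ ≤ r →
      c * tau 3 (criticalProbI 3) 0 ![(r : ℤ), (r : ℤ), 0] ≤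
        (bondPercolation (zdGraph 3) (criticalProbI 3)).real
          (openConnIn
            {x : Site 3 | -((r : ℤ) / 8) ≤ x 0 ∧ x 0 ≤ (r : ℤ) + (r : ℤ) / 8 ∧
              -((r : ℤ) / 8) ≤ x 1 ∧ x 1 ≤ (r : ℤ) + (r : ℤ) / 8 ∧
              -((r : ℤ) + (r : ℤ) / 8) ≤ x 2 ∧ x 2 ≤ (r : ℤ) / 8}
            (0 : Site 3) ![(r : ℤ), (r : ℤ), 0])) :
    ∃ c₂ : ℝ, 0 < c₂ ∧ ∃ r₀ : ℕ, ∀ r : ℕ, r₀ ≤ r →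
      c₂ * (bondPercolation (zdGraph 3) (criticalProbI 3)).real
          (openConnIn {x : Site 3 | 2 * x 2 + 2 ≤ (r : ℤ)} (0 : Site 3) ![(r : ℤ), (r : ℤ), 0] ∩
            openConnIn {x : Site 3 | (r : ℤ) + 2 ≤ 2 * x 2} (![(r : ℤ), 0, (r : ℤ)] : Site 3) ![0, (r : ℤ), (r : ℤ)]) ≤
        (bondPercolation (zdGraph 3) (criticalProbI 3)).real
          (openConnIn {x : Site 3 | 2 * x 2 + 2 ≤ (r : ℤ)} (0 : Site 3) ![(r : ℤ), (r : ℤ), 0] ∩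
            openConnIn {x : Site 3 | (r : ℤ) + 2 ≤ 2 * x 2} (![(r : ℤ), 0, (r : ℤ)] : Site 3) ![0, (r : ℤ), (r : ℤ)] ∩
            (openConn (0 : Site 3) ![(r : ℤ), 0, (r : ℤ)])ᶜ) := by
  obtain ⟨cX, hcX, hX⟩ := hXB
  obtain ⟨c, hc, r₁, hC⟩ := hCore
  refine ⟨cX * c ^ 2, by positivity, max r₁ 56, fun r hr => ?_⟩
  have hr₁ : r₁ ≤ r := le_trans (le_max_left _ _) hr
  have hr56 : 56 ≤ r := le_trans (le_max_right _ _) hr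
  -- the objects
  set k : ℤ := (r : ℤ) / 8 with hk
  set Core : Set (Site 3) :=
    {x : Site 3 | -((r : ℤ) / 8) ≤ x 0 ∧ x 0 ≤ (r : ℤ) + (r : ℤ) / 8 ∧
      -((r : ℤ) / 8) ≤ x 1 ∧ x 1 ≤ (r : ℤ) + (r : ℤ) / 8 ∧
      -((r : ℤ) + (r : ℤ) / 8) ≤ x 2 ∧ x 2 ≤ (r : ℤ) / 8} with hCore_def
  set v : Site 3 := ![4 * (k + 1), 4 * (k + 1), -(4 * (k + 1))] with hv
  set n : ℕ := 5 * (r / 8 + 1) with hn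
  have hn_cast : (n : ℤ) = 5 * (k + 1) := by
    simp only [hn, hk]; push_cast; ring
  have hn1 : 1 ≤ n := by omega
  set Outer : Set (Site 3) := {u : Site 3 | u - v ∈ box 3 (2 * n)} with hOuter
  set Inner : Set (Site 3) := {u : Site 3 | u - v ∈ box 3 n} with hInner
  set W : Set (Site 3) := {x : Site 3 | 6 * (k + 1) + 1 ≤ x 2} with hW_def
  have hv0 : v 0 = 4 * (k + 1) := rfl
  have hv1 : v 1 = 4 * (k + 1) := rfl
  have hv2 : v 2 = -(4 * (k + 1)) := rfl
  -- membership unfolding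
  have mem_Outer : ∀ u : Site 3, u ∈ Outer ↔
      ∀ i : Fin 3, -((2 * n : ℕ) : ℤ) ≤ u i - v i ∧ u i - v i ≤ ((2 * n : ℕ) : ℤ) := by
    intro u; simp only [hOuter, Set.mem_setOf_eq, mem_box, Pi.sub_apply]
  have mem_Inner : ∀ u : Site 3, u ∈ Inner ↔
      ∀ i : Fin 3, -(n : ℤ) ≤ u i - v i ∧ u i - v i ≤ (n : ℤ) := by
    intro u; simp only [hInner, Set.mem_setOf_eq, mem_box, Pi.sub_apply]
  have mem_Core : ∀ u : Site 3, u ∈ Core ↔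
      -((r : ℤ) / 8) ≤ u 0 ∧ u 0 ≤ (r : ℤ) + (r : ℤ) / 8 ∧
      -((r : ℤ) / 8) ≤ u 1 ∧ u 1 ≤ (r : ℤ) + (r : ℤ) / 8 ∧
      -((r : ℤ) + (r : ℤ) / 8) ≤ u 2 ∧ u 2 ≤ (r : ℤ) / 8 := fun u => Iff.rfl
  have h2n : ((2 * n : ℕ) : ℤ) = 10 * (k + 1) := by push_cast; rw [hn_cast]; ring
  -- geometry (`r ≥ 56` gives `k ≥ 7`, and `8k ≤ r ≤ 8k + 7`)
  have hRR' : Core ⊆ Outer := by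
    intro u hu
    rw [mem_Core] at hu
    rw [mem_Outer]
    intro i
    fin_cases i <;> simp only [Fin.zero_eta, Fin.mk_one, Fin.reduceFinMk, Fin.isValue, hv0, hv1, hv2, h2n] <;> omega
  have hN : ∀ x ∈ Core, ∀ y, (zdGraph 3).Adj x y → y ∈ Outer := by
    intro x hx y hxy
    rw [mem_Core] at hx
    rw [mem_Outer]
    have h0 := zdGraph_adj_apply_le hxy 0
    have h1 := zdGraph_adj_apply_le hxy 1
    have h2 := zdGraph_adj_apply_le hxy 2
    intro i
    fin_cases i <;> simp only [Fin.zero_eta, Fin.mk_one, Fin.reduceFinMk, Fin.isValue, hv0, hv1, hv2, h2n] <;> omega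
  have hI : ∀ u, u ∉ Core → (∃ z ∈ Core, (zdGraph 3).Adj u z) → u ∈ Inner := by
    rintro u - ⟨z, hz, huz⟩
    rw [mem_Core] at hz
    rw [mem_Inner]
    have h0 := zdGraph_adj_apply_le huz 0
    have h1 := zdGraph_adj_apply_le huz 1
    have h2 := zdGraph_adj_apply_le huz 2
    intro i
    fin_cases i <;> simp only [Fin.zero_eta, Fin.mk_one, Fin.reduceFinMk, Fin.isValue, hv0, hv1, hv2, hn_cast] <;> omega
  have hWdisj : Disjoint Outer W := by
    rw [Set.disjoint_left]
    intro u hu huW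
    rw [mem_Outer] at hu
    have h2 := hu 2
    simp only [hW_def, Set.mem_setOf_eq] at huW
    rw [hv2, h2n] at h2
    omega
  have hCoreW : Core ⊆ {x : Site 3 | x 2 ≤ (r : ℤ) - (6 * (k + 1) + 1)} := by
    intro u hu
    rw [mem_Core] at hu
    simp only [Set.mem_setOf_eq]
    omega
  have hCoreH : Core ⊆ {x : Site 3 | 2 * x 2 + 2 ≤ (r : ℤ)} := by
    intro u hu
    rw [mem_Core] at hu
    simp only [Set.mem_setOf_eq]
    omega
  have hWU : W ⊆ {x : Site 3 | (r : ℤ) + 2 ≤ 2 * x 2} := by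
    intro u hu
    simp only [hW_def, Set.mem_setOf_eq] at hu
    simp only [Set.mem_setOf_eq]
    omega
  -- restricted-conclusion decoupling
  have hdec := linkBlocking_shellDecoupling (zdGraph 3) (criticalProbI 3) hRR' hN hWdisj hCoreH hWU
    (0 : Site 3) ![(r : ℤ), (r : ℤ), 0] ![(r : ℤ), 0, (r : ℤ)] ![0, (r : ℤ), (r : ℤ)]
  -- X_B: the shell has probability ≥ cX
  have hShell : cX ≤ (bondPercolation (zdGraph 3) (criticalProbI 3)).real
      {ω | ∀ u ∈ Outer \ Core, ∀ w ∈ Outer \ Core, (∃ z ∈ Core, (zdGraph 3).Adj u z) →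
        (∃ z ∉ Outer, (zdGraph 3).Adj w z) → ω ∉ openConnIn (Outer \ Core) u w} := by
    have hsup := transferC_shell_superset_compl (zdGraph 3) (R := Core) (R' := Outer) (I := Inner) hI
    have hXBn := hX n hn1
    have hshift := stub_shiftBoxCrossing (criticalProbI 3) v n
    have hev : {ω : BondConfig (Site 3) | ∃ x ∈ Inner, ∃ y ∈ Outer,
        (∃ z ∉ Outer, (zdGraph 3).Adj y z) ∧ ω ∈ openConnIn Outer x y} =
        {ω | ∃ x : Site 3, x - v ∈ box 3 n ∧ ∃ y : Site 3, y - v ∈ box 3 (2 * n) ∧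
          (∃ z : Site 3, z - v ∉ box 3 (2 * n) ∧ (zdGraph 3).Adj y z) ∧
          ω ∈ openConnIn {u : Site 3 | u - v ∈ box 3 (2 * n)} x y} := by
      ext ω
      constructor
      · rintro ⟨x, hx, y, hy, ⟨z, hz, hyz⟩, hω⟩
        exact ⟨x, hx, y, hy, ⟨z, hz, hyz⟩, hω⟩
      · rintro ⟨x, hx, y, hy, ⟨z, hz, hyz⟩, hω⟩
        exact ⟨x, hx, y, hy, ⟨z, hz, hyz⟩, hω⟩
    have hunion : (bondPercolation (zdGraph 3) (criticalProbI 3)).real Set.univ ≤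
        (bondPercolation (zdGraph 3) (criticalProbI 3)).real
          {ω | ∀ u ∈ Outer \ Core, ∀ w ∈ Outer \ Core, (∃ z ∈ Core, (zdGraph 3).Adj u z) →
            (∃ z ∉ Outer, (zdGraph 3).Adj w z) → ω ∉ openConnIn (Outer \ Core) u w} +
        (bondPercolation (zdGraph 3) (criticalProbI 3)).real
          {ω : BondConfig (Site 3) | ∃ x ∈ Inner, ∃ y ∈ Outer,
            (∃ z ∉ Outer, (zdGraph 3).Adj y z) ∧ ω ∈ openConnIn Outer x y} := by
      refine le_trans (measureReal_mono ?_) (measureReal_union_le _ _)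
      intro ω _
      by_cases hω : ω ∈ {ω : BondConfig (Site 3) | ∃ x ∈ Inner, ∃ y ∈ Outer,
          (∃ z ∉ Outer, (zdGraph 3).Adj y z) ∧ ω ∈ openConnIn Outer x y}
      · exact Or.inr hω
      · exact Or.inl (hsup hω)
    rw [probReal_univ, hev, hshift] at hunion
    linarith
  -- core restriction: the two cube/half-space-restricted connections
  have hA := hC r hr₁
  have hB : c * tau 3 (criticalProbI 3) 0 ![(r : ℤ), (r : ℤ), 0] ≤
      (bondPercolation (zdGraph 3) (criticalProbI 3)).real
        (openConnIn W (![(r : ℤ), 0, (r : ℤ)] : Site 3) ![0, (r : ℤ), (r : ℤ)]) := by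
    have hm := stub_mirrorRestrict (criticalProbI 3) r (6 * (k + 1) + 1)
    rw [hm]
    exact le_trans hA (measureReal_mono (openConnIn_mono hCoreW _ _))
  -- the two half-space-restricted connections are bounded by `τ(0,a_r)` and independent
  have hPA : (bondPercolation (zdGraph 3) (criticalProbI 3)).real
      (openConnIn {x : Site 3 | 2 * x 2 + 2 ≤ (r : ℤ)} (0 : Site 3) ![(r : ℤ), (r : ℤ), 0]) ≤
      tau 3 (criticalProbI 3) 0 ![(r : ℤ), (r : ℤ), 0] := by
    rw [tau_def]
    exact measureReal_mono (openConnIn_subset_openConn _ _ _)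
  have hPB : (bondPercolation (zdGraph 3) (criticalProbI 3)).real
      (openConnIn {x : Site 3 | (r : ℤ) + 2 ≤ 2 * x 2} (![(r : ℤ), 0, (r : ℤ)] : Site 3)
        ![0, (r : ℤ), (r : ℤ)]) ≤
      tau 3 (criticalProbI 3) 0 ![(r : ℤ), (r : ℤ), 0] := by
    rw [stub_restrictSymm]
    exact hPA
  have hind := stub_restrictProduct (zdGraph 3) (criticalProbI 3) (lower_upper_disjoint r)
    (0 : Site 3) ![(r : ℤ), (r : ℤ), 0] ![(r : ℤ), 0, (r : ℤ)] ![0, (r : ℤ), (r : ℤ)]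
  have hτnn : 0 ≤ tau 3 (criticalProbI 3) 0 ![(r : ℤ), (r : ℤ), 0] := tau_nonneg _ _ _
  have hcτ : 0 ≤ c * tau 3 (criticalProbI 3) 0 ![(r : ℤ), (r : ℤ), 0] := by positivity
  rw [hind]
  refine le_trans ?_ hdec
  calc cX * c ^ 2 * ((bondPercolation (zdGraph 3) (criticalProbI 3)).real
            (openConnIn {x : Site 3 | 2 * x 2 + 2 ≤ (r : ℤ)} (0 : Site 3) ![(r : ℤ), (r : ℤ), 0]) *
          (bondPercolation (zdGraph 3) (criticalProbI 3)).real
            (openConnIn {x : Site 3 | (r : ℤ) + 2 ≤ 2 * x 2} (![(r : ℤ), 0, (r : ℤ)] : Site 3)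
              ![0, (r : ℤ), (r : ℤ)]))
      ≤ cX * c ^ 2 * (tau 3 (criticalProbI 3) 0 ![(r : ℤ), (r : ℤ), 0] *
          tau 3 (criticalProbI 3) 0 ![(r : ℤ), (r : ℤ), 0]) :=
        mul_le_mul_of_nonneg_left (mul_le_mul hPA hPB measureReal_nonneg hτnn) (by positivity)
    _ = (c * tau 3 (criticalProbI 3) 0 ![(r : ℤ), (r : ℤ), 0]) * cX *
          (c * tau 3 (criticalProbI 3) 0 ![(r : ℤ), (r : ℤ), 0]) := by ring
    _ ≤ _ := mul_le_mul (mul_le_mul hA hShell hcX.le measureReal_nonneg) hB hcτ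
          (mul_nonneg measureReal_nonneg measureReal_nonneg)

end Summit.CriticalPhenomena.PercolationContinuityZ3.Theorems.TetrahedronDisjointCoexistence

end
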